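import Summits.FinalStateConjecture.FinalStateConjecture.Theorems.StarvedNecksGapDecaySufficesStubAnchoredLocationV2

/-!
# Line `Sketch` of crux `GapDecaySuffices` (stmt-FinalStateConjecture-18060) — stub `stub_lateSeed` (X₂, v10):
# the isolated TRANSPORT statement `BandTransport`

Statement bundle only (one `def … : Prop`), consumed by the reduction
`…LateSeedX2.lateSeed_of_bandTransport : BandTransport → V10.LateSeed` (file
`…StubLateSeedReduction.lean`) and proved in `…StubLateSeedTransport*.lean`.

`BandTransport` is the band-transport step of the WHY-TRUE plan of `V10.LateSeed` (= the v9
`Location.Seeded.LateSeed` docstring, case (b)): a late point `x'` of the input hole chart `Ψᵢ`'s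
honest band `R₀ ≤ rᵢ ≤ L` (here `L = L(s)` is any non-negative sublinear radius profile read at a
flat-time parameter `s` with `s / C ≤ tᵢ x' + 1`) has a `Ψg`-preimage `x` in the gap chart's honest
region, `Ψg x = Ψᵢ x'`, COARSELY LOCATED: `tᵢ x ≥ tᵢ x' − 20 (L + R₀ + 1)` and `rᵢ x ≤ W(x⁰)`.
Its antecedents are `HonestCore`, `HonestFar` (only `Hc`(1) and `Hf`(3) are used), the gap
certificate clauses G1, G2, G3, G5 VERBATIM (those of `V10.LateSeed`), and two eventual-in-`s`
kinematic clauses which the reduction discharges from the wall clause `W ≥ 3ρ' + 2`, the clock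
bound, concavity of `ρ'` and cone separation: (WALL) the gap wall clears radius `50 (L + R₀ + 1)`
with margin `1` at hole times `≥ s / C − 20 (L + R₀ + 1)`; (CELL) such points with `R₀ ≤ rᵢ` lie in
the honest cell `rᵢ ≤ rⱼ` of hole `i`.  It holds for EVERY spacetime (no development structure is
needed): the proof is a clopen continuation over nested coordinate double-cones in the two charts,
located by pulling narrow-timelike coordinate segments of `Ψᵢ`'s chart back through `Ψg` (local
inverse function theorem) into wide-cone-causal curves of `Ψg`'s chart.

References: O'Neill 1983, Ch. 5, Lemma 5.26 (cone algebra); the method of continuity.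
-/
noncomputable section

open scoped Manifold ContDiff Topology ENNReal
open Filter Set Topology Literature.Geometry.Lorentzian

namespace Summit.FinalStateConjecture.FinalStateConjecture.Theorems.GapDecaySuffices.LateSeedX2

-- justified lint debt: the problem namespace repeats the summit name (`FinalStateConjecture.FinalStateConjecture`)
set_option linter.dupNamespace false

open Location.AnchoredV2 (HonestCore HonestFar)

/-- **`BandTransport`** — transport of late points of the input hole chart's honest band into the
gap chart, with coarse location (the isolated geometric step of `V10.LateSeed`).  For a final-state
decomposition `d` of a region `O` of ANY spacetime with `HonestCore`/`HonestFar` at scale `R₀`, a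
hole `i`, and a gap chart `Ψg` with G1 (smooth open embedding of the tube `{τ₁ < tᵢ, rᵢ < W(x⁰) + 1}`),
G2 (`Ψg = Ψᵢ` inside `R₁ + 1`), G3 (`C²` honesty below the wall) and G5 (relative closedness of
sub-wall tube portions): for every `C > 0` and every non-negative sublinear profile `L`, if
eventually in `s` (WALL) `rᵢ x + 1 ≤ W(x⁰)` whenever `s / C − 20 (L s + R₀ + 1) ≤ tᵢ x` and
`rᵢ x ≤ 50 (L s + R₀ + 1)`, and (CELL) `rᵢ y ≤ rⱼ y` (`j ≠ i`) whenever moreover `R₀ ≤ rᵢ y`, then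
eventually in `s` every model point `x'` with `s / C ≤ tᵢ x' + 1`, `R₀ ≤ rᵢ x' ≤ L s` has a gap-chart
preimage `x`, `Ψg x = Ψᵢ x'`, with `tᵢ x' − 20 (L s + R₀ + 1) ≤ tᵢ x` and `rᵢ x ≤ W(x⁰)`. -/
def BandTransport : Prop :=
  ∀ (𝓢 : Spacetime.{0} 4) (O : Set 𝓢.carrier) (d : FinalStateDecomposition 𝓢 O 4) (R₀ : ℝ),
    HonestCore 𝓢 O 4 d R₀ → HonestFar 𝓢 O 4 d R₀ →
    ∀ (i : Fin d.N) (R₁ τ₁ : ℝ) (W : ℝ → ℝ) (Ψg : (d.background i).domain → 𝓢.carrier),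
      let B := d.background i; let t := B.time; let r := B.radius;
      R₀ ≤ R₁ → d.τ₀ ≤ τ₁ → Continuous W →
      (let U : Set B.domain := {x | τ₁ < t x.1 ∧ r x.1 < W (x.1 0) + 1};
        ContMDiffOn 𝓘(ℝ, E4) (𝓡 4) ∞ Ψg U ∧ Topology.IsOpenEmbedding (U.restrict Ψg) ∧
          Ψg '' U ⊆ d.charted) →
      (∀ x : B.domain, r x.1 ≤ R₁ + 1 → Ψg x = d.chart i x) →
      Tendsto (fun τ ↦ supCkENorm (Subtype.val '' {x : B.domain | t x.1 = τ ∧ r x.1 ≤ W (x.1 0)}) 2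
        (𝓢.deviationExtend B Ψg)) atTop (𝓝 0) →
      (∀ (τ' : ℝ) (ϱ : ℝ → ℝ), Continuous ϱ → τ₁ < τ' →
        (∀ x : B.domain, τ' ≤ t x.1 → r x.1 ≤ ϱ (t x.1) → r x.1 ≤ W (x.1 0)) →
        closure (Ψg '' {x | τ' ≤ t x.1 ∧ r x.1 ≤ ϱ (t x.1)}) ∩ O ⊆
          Ψg '' {x | τ' ≤ t x.1 ∧ r x.1 ≤ ϱ (t x.1)}) →
      ∀ (C : ℝ) (L : ℝ → ℝ), 0 < C → (∀ s, 0 ≤ L s) → Tendsto (fun s ↦ L s / s) atTop (𝓝 0) →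
        (∀ᶠ s in atTop, ∀ x : B.domain, s / C - 20 * (L s + R₀ + 1) ≤ t x.1 →
          r x.1 ≤ 50 * (L s + R₀ + 1) → r x.1 + 1 ≤ W (x.1 0)) →
        (∀ᶠ s in atTop, ∀ y : E4, s / C - 20 * (L s + R₀ + 1) ≤ t y → R₀ ≤ r y →
          r y ≤ 50 * (L s + R₀ + 1) → ∀ j, j ≠ i → r y ≤ (d.background j).radius y) →
        ∀ᶠ s in atTop, ∀ x' : B.domain, s / C ≤ t x'.1 + 1 → R₀ ≤ r x'.1 → r x'.1 ≤ L s →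
          ∃ x : B.domain, Ψg x = d.chart i x' ∧ t x'.1 - 20 * (L s + R₀ + 1) ≤ t x.1 ∧
            r x.1 ≤ W (x.1 0)

end Summit.FinalStateConjecture.FinalStateConjecture.Theorems.GapDecaySuffices.LateSeedX2

end
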